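import Summits.Ventures.HodgeRepro2.T5SU11KernelCompositionODE
import Summits.Ventures.HodgeRepro2.T5SU11RadialGreenImproperUnique
import Summits.Ventures.HodgeRepro2.T5SU11ResolventBoundaryEdge
import Summits.Ventures.HodgeRepro2.T5SU11KernelDerivative

/-!
# The composed kernels are characterised by their equation: `K_λ^{∘(n+2)}(·, s)` is THE solution of
`(L − μ) v = K_λ^{∘(n+1)}(·, s)` that is bounded at the origin and `o(φ_λ)` at infinity

Row 610 showed that the composed kernel `K_λ^{∘(n+2)}(·, s) = G^I_λ K_λ^{∘(n+1)}(·, s)` solves the inhomogeneous radial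
equation with source `K_λ^{∘(n+1)}(·, s)`. With row 575's `W_1`-bound `|K_λ^{∘(m+1)}(t, s)| ≤ D_s Ξ(t)` and `Ξ/φ_λ → 0`:

* `kernel_comp_bounded_nhdsGT_zero` — **`K_λ^{∘(m+1)}(·, s)` is bounded near the origin**;
* `tendsto_kernel_comp_div_sph_atTop` — **`K_λ^{∘(m+1)}(t, s)/φ_λ(a_t) → 0`** as `t → ∞`;
* `eq_kernel_comp_succ_of_ode` — **uniqueness: every `C²` solution `v` of `(L − μ) v = K_λ^{∘(n+1)}(·, s)` on `(0, ∞)` that is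
  bounded near `0` and `o(φ_λ)` at infinity equals `K_λ^{∘(n+2)}(·, s)`** (row 499's `eq_greenSolI_of_ode` on the class source
  `K_λ^{∘(n+1)}(·, s)`).

Nothing is claimed about (N).

Blind lane: Mathlib + the HodgeRepro2 prefix only; no sorry; axioms ⊆ {propext, Classical.choice,
Quot.sound}.
-/

namespace Summit.Ventures.HodgeRepro2.T5SU11KernelCompositionUnique

open Filter Topology MeasureTheory
open Set (Ioi Ioc)
open T5SU11Cartan T5SU11SphericalFunction T5SU11SphericalBounds T5SU11SphericalDecay T5SU11RadialGreenKernel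
  T5SU11RadialGreenImproper T5SU11RadialGreenImproperUnique T5SU11ResolventNeumann T5SU11KernelDifferenceRegularity
  T5SU11KernelDerivative T5SU11WeightedSpaceGroundState T5SU11ResolventBoundaryEdge T5SU11KernelCompositionODE

section measure

variable [MeasurableSpace Circle] [BorelSpace Circle]

variable {lam : ℝ} (hlam : 1 < lam) {s : ℝ} (hs : 0 < s)

include hlam hs in
/-- **The composed kernels are bounded near the origin**: `|K_λ^{∘(m+1)}(t, s)| ≤ D` for `t` near `0⁺` (row 575's `W_1`-bound
and `Ξ ≤ 1`). -/
theorem kernel_comp_bounded_nhdsGT_zero (m : ℕ) :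
    ∃ B : ℝ, ∀ᶠ t in 𝓝[>] (0 : ℝ),
      |((greenSolI (fun t => sph lam (hyp t)) (sphDecay lam))^[m] (fun r => sphGreenKernel lam r s)) t| ≤ B := by
  obtain ⟨D, hD0, hD⟩ := kernel_source_mem_weighted_one hlam hs
  have hg := kernel_source_continuousOn hlam hs
  obtain ⟨_, hb⟩ := iterate_mem_weighted_one hlam hg hD m
  refine ⟨D / ((lam - 1) ^ 2) ^ m, ?_⟩
  filter_upwards [self_mem_nhdsWithin] with t ht
  have hΞ : sph 1 (hyp t) ≤ 1 := sph_hyp_le_one zero_le_one one_le_two t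
  have hr : 0 ≤ D / ((lam - 1) ^ 2) ^ m := by
    have : 0 < lam - 1 := by linarith
    positivity
  calc |((greenSolI (fun t => sph lam (hyp t)) (sphDecay lam))^[m] (fun r => sphGreenKernel lam r s)) t|
      ≤ D * sph 1 (hyp t) / ((lam - 1) ^ 2) ^ m := hb t ht
    _ = D / ((lam - 1) ^ 2) ^ m * sph 1 (hyp t) := by ring
    _ ≤ D / ((lam - 1) ^ 2) ^ m * 1 := mul_le_mul_of_nonneg_left hΞ hr
    _ = D / ((lam - 1) ^ 2) ^ m := mul_one _

include hlam hs in
/-- **The composed kernels are `o(φ_λ)` at infinity**: `K_λ^{∘(m+1)}(t, s)/φ_λ(a_t) → 0`. -/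
theorem tendsto_kernel_comp_div_sph_atTop (m : ℕ) :
    Tendsto (fun t => ((greenSolI (fun t => sph lam (hyp t)) (sphDecay lam))^[m] (fun r => sphGreenKernel lam r s)) t
      / sph lam (hyp t)) atTop (𝓝 0) := by
  obtain ⟨D, _, hD⟩ := kernel_source_mem_weighted_one hlam hs
  have hg := kernel_source_continuousOn hlam hs
  obtain ⟨_, hb⟩ := iterate_mem_weighted_one hlam hg hD m
  have hΞ := tendsto_sph_one_hyp_div_atTop hlam
  have hdom : Tendsto (fun t => D / ((lam - 1) ^ 2) ^ m * (sph 1 (hyp t) / sph lam (hyp t))) atTop (𝓝 0) := by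
    simpa using hΞ.const_mul (D / ((lam - 1) ^ 2) ^ m)
  refine squeeze_zero_norm' ?_ hdom
  filter_upwards [eventually_gt_atTop 0] with t ht
  have hφ : 0 < sph lam (hyp t) := sph_hyp_pos lam t
  rw [Real.norm_eq_abs, abs_div, abs_of_pos hφ, div_le_iff₀ hφ]
  calc |((greenSolI (fun t => sph lam (hyp t)) (sphDecay lam))^[m] (fun r => sphGreenKernel lam r s)) t|
      ≤ D * sph 1 (hyp t) / ((lam - 1) ^ 2) ^ m := hb t ht
    _ = D / ((lam - 1) ^ 2) ^ m * (sph 1 (hyp t) / sph lam (hyp t)) * sph lam (hyp t) := by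
        field_simp

include hlam hs in
/-- **UNIQUENESS**: a `C²` function `v` on `(0, ∞)` with `(L − μ) v = K_λ^{∘(n+1)}(·, s)`, bounded near the origin and `o(φ_λ)`
at infinity, is the composed kernel `K_λ^{∘(n+2)}(·, s)`. -/
theorem eq_kernel_comp_succ_of_ode (n : ℕ) {v v' v'' : ℝ → ℝ}
    (hv : ∀ t, 0 < t → HasDerivAt v (v' t) t) (hv' : ∀ t, 0 < t → HasDerivAt v' (v'' t) t)
    (hvode : ∀ t, 0 < t → Real.sinh (2 * t) * v'' t + 2 * Real.cosh (2 * t) * v' t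
      = lam * (lam - 2) * Real.sinh (2 * t) * v t + Real.sinh (2 * t)
        * ((greenSolI (fun t => sph lam (hyp t)) (sphDecay lam))^[n] (fun r => sphGreenKernel lam r s)) t)
    {B : ℝ} (hB : ∀ᶠ t in 𝓝[>] (0 : ℝ), |v t| ≤ B)
    (hdecay : Tendsto (fun t => v t / sph lam (hyp t)) atTop (𝓝 0)) {t : ℝ} (ht : 0 < t) :
    v t = ((greenSolI (fun t => sph lam (hyp t)) (sphDecay lam))^[n + 1] (fun r => sphGreenKernel lam r s)) t := by
  -- the class data of the source `K_λ^{∘(n+1)}(·, s)` (row 503)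
  obtain ⟨Ms, hMs0, hMs⟩ := kernel_source_bounded hlam hs
  obtain ⟨Cs, s₀, hCs⟩ := kernel_source_decay hlam hs
  have hks := kernel_source_continuousOn hlam hs
  have hεk : 2 - lam < lam := by linarith
  obtain ⟨hcn, ⟨Mn, hMn0, hMn⟩, hdn⟩ := iterate_class (lam₂ := lam) hlam hks hMs hMs0 hεk hCs n
  obtain ⟨Kn, Tn, _, _, hKn⟩ := hdn ((1 + lam) / 2) (by rw [min_self]; linarith)
  have hε : 2 - lam < (1 + lam) / 2 := by linarith
  rw [Function.iterate_succ_apply']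
  exact eq_greenSolI_of_ode hlam hcn hMn hMn0 hε hKn hv hv' hvode hB hdecay ht

end measure

end Summit.Ventures.HodgeRepro2.T5SU11KernelCompositionUnique
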